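import Literature.Analysis.UnboundedOperators.DiagonalOperatorCompact
import Mathlib.Analysis.SpecialFunctions.Pow.Asymptotics
import Mathlib.Topology.UniformSpace.UniformApproximation
import HarnessLib

/-!
# The semigroup frame `(1 + A)^{-1/2}`, `(1 + A)⁻¹`, `e^{-tA}`, `A^{3/4} e^{-tA}` of a
# non-negative diagonal operator

Topic `Literature/Analysis/FluidPDE`; abstract core of `StokesTorusSemigroup.lean` (the Stokes
semigroup on the energy space of the flat torus) and companion of `StokesTorusResolvent.lean` /
`StokesTorusSqrtResolvent.lean`.  For a Hilbert basis `b` of a real Hilbert space `H` and a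
non-negative symbol `m : ι → ℝ` with `m i → ∞` along the cofinite filter — the situation of the
Stokes operator `A = b.diagonalPMap m` in its eigenbasis (`exists_hilbertBasis_stokes_holds`) — the
functional calculus of the self-adjoint operator `A = diag(m)` is the calculus of bounded diagonal
operators `b.diagonalCLM (f ∘ m)` (`Literature/Analysis/UnboundedOperators/DiagonalOperator.lean`).

**Theorems** (no definitions, no named facts):

* a small calculus of bounded *real* diagonal operators `b.diagonalCLM s` (`s ∈ ℓ^∞(ι, ℝ)`):
  packaging of bounded families as symbols (`exists_lp_infty_coe_eq`), extensionality
  (`diagonalCLM_congr`), self-adjointness (`isSelfAdjoint_diagonalCLM`), composition = product of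
  symbols and commutativity (`diagonalCLM_comp_eq`, `diagonalCLM_comp_comm`), the norm bound
  (`norm_diagonalCLM_le_of_forall_le`), injectivity (`diagonalCLM_injective`), and **strong
  continuity** of a uniformly bounded family with continuous symbol
  (`continuous_diagonalCLM_apply`; Engel–Nagel, multiplication semigroups on `ℓ²`);
* the scalar smoothing inequality `x^α e^{-tx} ≤ t^{-α}` for `0 ≤ α ≤ 1`
  (`rpow_mul_exp_neg_le_rpow_neg`);
* `exists_semigroupFrame_diagonalPMap` — the **semigroup frame** of `A = b.diagonalPMap m`: the
  bounded diagonal operators `S = (1 + A)^{-1/2}` (symbol `(1 + m)^{-1/2}`),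
  `R = S ∘ S = (1 + A)⁻¹`, the semigroup `T t = e^{-tA}` (symbol `e^{-t m}`, `t ≥ 0`) and the
  smoothed semigroup `K t = A^{3/4} e^{-tA}` (symbol `m^{3/4} e^{-t m}`, `t > 0`), with their laws:
  `S` is an injective self-adjoint compact contraction, `R` inverts `1 + A` on both sides and the
  frame identity `‖z‖² = ‖S z‖² + ⟪A (S z), S z⟫` holds; `T` is a strongly continuous contraction
  semigroup of self-adjoint operators commuting with `S`, compact for `t > 0`;
  `‖K t‖ ≤ t^{-3/4}`, `K (s + t) = T s ∘ K t`, `K` commutes with `S` and is strongly continuous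
  on `(0, ∞)`
  (Henry 1981, Thm. 1.3.4 and Thm. 1.4.3: `e^{-tA}` is an analytic semigroup and
  `‖A^α e^{-tA}‖ ≤ C_α t^{-α}`; Pazy 1983, Thm. 2.6.13; Engel–Nagel 2006, Ch. I Prop. 3.11 and
  Ch. II §2.9 (multiplication semigroups); Reed–Simon I, §VIII.3 Proposition 1, Thm. VIII.4–VIII.6
  (functional calculus of a self-adjoint multiplication operator)).

The companion `StokesTorusSemigroup.lean` restates the conjunction for any operator `A` *equal* to
`b.diagonalPMap m` and instantiates it on the Stokes eigenbasis of the flat torus.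

Design: theorem-only; the four families are produced existentially but described by their action
on the basis (`S (b i) = (1 + m i)^{-1/2} • b i`, …), which determines them.  Time is `t : ℝ`;
for `t < 0` the witnesses take the junk values `T t = 1` (symbol `e^{-(max t 0) m}`, which keeps
`t ↦ T t y` continuous on all of `ℝ`) and `K t = 0` (`t ≤ 0`); no conjunct speaks about them.
Deliberately NOT here: fractional powers `A^α` in general, analyticity of `e^{-tA}`, the Stokes
instantiation.

## References

* D. Henry, *Geometric Theory of Semilinear Parabolic Equations*, LNM 840 (Springer, 1981),
  Thm. 1.3.4, Thm. 1.4.3. [Henry1981]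
* A. Pazy, *Semigroups of Linear Operators and Applications to PDE* (Springer, 1983), Thm. 2.6.13.
  [Pazy1983]
* K.-J. Engel, R. Nagel, *A Short Course on Operator Semigroups* (Springer, 2006), Ch. I Lemma 1.2,
  Prop. 1.3, Prop. 3.11. [EngelNagel2006]
* M. Reed, B. Simon, *Methods of Modern Mathematical Physics I* (Academic Press, 1980), §VIII.3.
  [ReedSimonI1980]
* P. R. Halmos, *A Hilbert Space Problem Book*, 2nd ed. (Springer, 1982), Problems 61–63, 171.
-/

noncomputable section

open Filter
open scoped InnerProductSpace ENNReal Topology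

namespace Literature.Analysis.FluidPDE

variable {ι H : Type*} [NormedAddCommGroup H] [InnerProductSpace ℝ H] (b : HilbertBasis ι ℝ H)

/-! ### Calculus of bounded real diagonal operators -/

/-- A family of real sequences bounded for each parameter, `‖f x i‖ ≤ C x`, is (the coefficient
function of) a family of symbols in `ℓ^∞(ι, ℝ)` (Mathlib's `memℓp_infty`). [folklore] -/
theorem exists_lp_infty_coe_eq {X : Type*} {f : X → ι → ℝ} (C : X → ℝ)
    (hf : ∀ x i, ‖f x i‖ ≤ C x) :
    ∃ s : X → lp (fun _ : ι => ℝ) ∞, ∀ x i, s x i = f x i :=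
  ⟨fun x => ⟨f x, memℓp_infty ⟨C x, by rintro _ ⟨i, rfl⟩; exact hf x i⟩⟩, fun _ _ => rfl⟩

/-- Bounded diagonal operators with pointwise equal symbols are equal. [folklore] -/
theorem diagonalCLM_congr {s s' : lp (fun _ : ι => ℝ) ∞} (h : ∀ i, s i = s' i) :
    b.diagonalCLM s = b.diagonalCLM s' := by
  rw [lp.ext (funext h)]

/-- A bounded diagonal operator with real symbol is self-adjoint (Halmos, *A Hilbert Space
Problem Book*, Problem 63: `diag(m)† = diag(m̄)`; the tree's `HilbertBasis.adjoint_diagonalCLM`).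
[folklore] -/
theorem isSelfAdjoint_diagonalCLM [CompleteSpace H] (s : lp (fun _ : ι => ℝ) ∞) :
    IsSelfAdjoint (b.diagonalCLM s) := by
  have hstar : star s = s := lp.ext (funext fun i => star_trivial (s i))
  rw [IsSelfAdjoint, ContinuousLinearMap.star_eq_adjoint, b.adjoint_diagonalCLM, hstar]

/-- The composition of two bounded diagonal operators is the diagonal operator with the product
symbol (Halmos, Problem 62; the tree's `HilbertBasis.diagonalCLM_mul`). [folklore] -/
theorem diagonalCLM_comp_eq {s s' s'' : lp (fun _ : ι => ℝ) ∞} (h : ∀ i, s i * s' i = s'' i) :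
    (b.diagonalCLM s).comp (b.diagonalCLM s') = b.diagonalCLM s'' := by
  rw [← ContinuousLinearMap.mul_def, ← b.diagonalCLM_mul]
  exact diagonalCLM_congr b fun i => by rw [lp.infty_coeFn_mul, Pi.mul_apply, h]

/-- Bounded diagonal operators commute (Halmos, Problem 62). [folklore] -/
theorem diagonalCLM_comp_comm (s s' : lp (fun _ : ι => ℝ) ∞) :
    (b.diagonalCLM s).comp (b.diagonalCLM s') = (b.diagonalCLM s').comp (b.diagonalCLM s) := by
  rw [← ContinuousLinearMap.mul_def, ← ContinuousLinearMap.mul_def, ← b.diagonalCLM_mul,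
    ← b.diagonalCLM_mul, mul_comm]

/-- `‖diag(s)‖ ≤ C` as soon as `|s i| ≤ C` for all `i` and `0 ≤ C` (Halmos, Problem 61).
[folklore] -/
theorem norm_diagonalCLM_le_of_forall_le (s : lp (fun _ : ι => ℝ) ∞) {C : ℝ} (hC : 0 ≤ C)
    (h : ∀ i, ‖s i‖ ≤ C) : ‖b.diagonalCLM s‖ ≤ C :=
  (b.norm_diagonalCLM_le s).trans (lp.norm_le_of_forall_le hC h)

/-- A bounded diagonal operator with nowhere-vanishing symbol is injective. [folklore] -/
theorem diagonalCLM_injective {s : lp (fun _ : ι => ℝ) ∞} (h : ∀ i, s i ≠ 0) :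
    Function.Injective (b.diagonalCLM s) := by
  intro x y hxy
  apply b.repr.injective
  ext i
  have h' := congrArg (fun z => b.repr z i) hxy
  simp only [b.diagonalCLM_apply_repr] at h'
  exact mul_left_cancel₀ (h i) h'

/-- **Strong continuity of a uniformly bounded family of diagonal operators with continuous
symbol.**  If `x ↦ s x i` is continuous for every index `i` and `‖diag(s x)‖ ≤ C` for all `x`,
then every orbit `x ↦ diag(s x) v` is continuous: orbits of finite linear combinations of basis
vectors are finite sums of continuous scalar functions times fixed vectors, and by the uniform
bound every orbit is a uniform limit of such (Engel–Nagel, *A Short Course on Operator Semigroups*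
(2006), Ch. I Lemma 1.2 (b) ⇒ (a), Prop. 1.3 (c) ⇒ (a) and Prop. 3.11: multiplication semigroups
`e^{tq}` on `L^p(Ω, μ)`, here `ℓ²(ι)`).
[cite: EngelNagel2006, Ch. I Lemma 1.2, Prop. 1.3 and Prop. 3.11] -/
theorem continuous_diagonalCLM_apply {X : Type*} [TopologicalSpace X]
    (s : X → lp (fun _ : ι => ℝ) ∞) (hs : ∀ i, Continuous fun x => s x i) {C : ℝ}
    (hC : ∀ x, ‖b.diagonalCLM (s x)‖ ≤ C) (v : H) :
    Continuous fun x => b.diagonalCLM (s x) v := by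
  have hfin : ∀ (F : Finset ι) (c : ι → ℝ),
      Continuous fun x => b.diagonalCLM (s x) (∑ i ∈ F, c i • b i) := fun F c => by
    simp only [map_sum, map_smul, b.diagonalCLM_basis]
    exact continuous_finsetSum F fun i _ => ((hs i).smul continuous_const).const_smul (c i)
  refine continuous_of_uniform_approx_of_continuous fun u hu => ?_
  obtain ⟨ε, hε, hεu⟩ := Metric.mem_uniformity_dist.mp hu
  have hC1 : 0 < |C| + 1 := by positivity
  obtain ⟨F, hF⟩ :=
    ((b.hasSum_repr v).eventually (Metric.ball_mem_nhds v (div_pos hε hC1))).exists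
  refine ⟨fun x => b.diagonalCLM (s x) (∑ i ∈ F, b.repr v i • b i), hfin F _, fun x => hεu ?_⟩
  rw [dist_eq_norm, ← map_sub]
  have hδ : ‖v - ∑ i ∈ F, b.repr v i • b i‖ < ε / (|C| + 1) := by
    rw [← dist_eq_norm, dist_comm]
    exact hF
  calc ‖b.diagonalCLM (s x) (v - ∑ i ∈ F, b.repr v i • b i)‖
      ≤ ‖b.diagonalCLM (s x)‖ * ‖v - ∑ i ∈ F, b.repr v i • b i‖ :=
        (b.diagonalCLM (s x)).le_opNorm _
    _ ≤ |C| * (ε / (|C| + 1)) :=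
        mul_le_mul ((hC x).trans (le_abs_self C)) hδ.le (norm_nonneg _) (abs_nonneg C)
    _ < (|C| + 1) * (ε / (|C| + 1)) := mul_lt_mul_of_pos_right (lt_add_one _) (div_pos hε hC1)
    _ = ε := mul_div_cancel₀ ε hC1.ne'

/-- **The parabolic smoothing inequality with constant one**: for `0 ≤ α ≤ 1`, `0 < t` and
`0 ≤ x`, `x^α e^{-tx} ≤ t^{-α}` (from `(tx)^α ≤ max (1, tx) ≤ 1 + tx ≤ e^{tx}`); the scalar form
of `‖A^α e^{-tA}‖ ≤ C_α t^{-α}` for a non-negative self-adjoint `A` (Henry, *Geometric Theory of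
Semilinear Parabolic Equations* (1981), Thm. 1.4.3; Pazy 1983, Thm. 2.6.13 (c)). [folklore] -/
theorem rpow_mul_exp_neg_le_rpow_neg {α t x : ℝ} (hα0 : 0 ≤ α) (hα1 : α ≤ 1) (ht : 0 < t)
    (hx : 0 ≤ x) : x ^ α * Real.exp (-(t * x)) ≤ t ^ (-α) := by
  have htx : 0 ≤ t * x := mul_nonneg ht.le hx
  have h1 : (t * x) ^ α ≤ Real.exp (t * x) := by
    refine le_trans ?_ (Real.add_one_le_exp _)
    rcases le_total (t * x) 1 with h | h
    · exact (Real.rpow_le_one htx h hα0).trans (by linarith)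
    · calc (t * x) ^ α ≤ (t * x) ^ (1 : ℝ) := Real.rpow_le_rpow_of_exponent_le h hα1
        _ = t * x := Real.rpow_one _
        _ ≤ t * x + 1 := by linarith
  rw [Real.mul_rpow ht.le hx] at h1
  rw [Real.rpow_neg ht.le, ← one_div, le_div_iff₀ (Real.rpow_pos_of_pos ht α)]
  calc x ^ α * Real.exp (-(t * x)) * t ^ α = t ^ α * x ^ α * Real.exp (-(t * x)) := by ring
    _ ≤ Real.exp (t * x) * Real.exp (-(t * x)) :=
        mul_le_mul_of_nonneg_right h1 (Real.exp_pos _).le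
    _ = 1 := by rw [← Real.exp_add, add_neg_cancel, Real.exp_zero]

/-! ### The semigroup frame of a non-negative diagonal operator -/

/-- **Semigroup frame of a non-negative diagonal operator with divergent symbol.**  Let `b` be a
Hilbert basis of a real Hilbert space `H` and `m : ι → ℝ` a symbol with `0 ≤ m i` and `m i → ∞`
along the cofinite filter; write `A = b.diagonalPMap m` (self-adjoint, non-negative, with compact
resolvent).  Then there are bounded operators `S R : H →L[ℝ] H` and families
`T K : ℝ → (H →L[ℝ] H)` — namely the diagonal operators `S = (1 + A)^{-1/2}`
(`S (b i) = (1 + m i)^{-1/2} b i`), `R = (1 + A)⁻¹` (`R (b i) = (1 + m i)⁻¹ b i`), `T t = e^{-tA}`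
(`T t (b i) = e^{-t m i} b i`, `t ≥ 0`) and `K t = A^{3/4} e^{-tA}`
(`K t (b i) = m i^{3/4} e^{-t m i} b i`, `t > 0`) — such that: `S ∘ S = R`; `S` is injective,
`‖S‖ ≤ 1`, self-adjoint and compact; `R v ∈ D(A)` with `R v + A (R v) = v` for all `v`,
`R (v + A v) = v` on `D(A)`; the frame identity
`‖z‖² = ‖S z‖² + ⟪A (S z), S z⟫` for `S z ∈ D(A)`; `‖T t‖ ≤ 1` (`t ≥ 0`), `T 0 = 1`,
`T (s + t) = T s ∘ T t` (`s, t ≥ 0`), `t ↦ T t y` continuous, `T t ∘ S = S ∘ T t`, `T t`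
self-adjoint (`t ≥ 0`) and compact (`t > 0`); `‖K t‖ ≤ t^{-3/4}` (`t > 0`), `K (s + t) = T s ∘ K t`
(`s ≥ 0`, `t > 0`), `K t ∘ S = S ∘ K t`, and `t ↦ K t y` continuous on `(0, ∞)`.  This is the
spectral-calculus content of: `-A` generates an analytic contraction semigroup of self-adjoint
operators with `‖A^α e^{-tA}‖ ≤ C_α t^{-α}` (Henry 1981, Thm. 1.3.4 and Thm. 1.4.3, here `α = 3/4`,
`C_α = 1`; Pazy 1983, Thm. 2.6.13), realised as the multiplication semigroup `e^{-tm}` on `ℓ²(ι)`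
(Engel–Nagel 2006, Ch. I Prop. 3.11; Reed–Simon I, §VIII.3 Proposition 1 and Thm. VIII.4–VIII.6 for
the functional calculus `f(A) = diag(f ∘ m)`), compactness from `e^{-t m i} → 0`,
`(1 + m i)^{-1/2} → 0` (Reed–Simon I, Thm. VI.12–VI.13).  For `t < 0` the witnesses are the junk
values `T t = 1`, `K t = 0` (also `K 0 = 0`), about which nothing is asserted.
[cite: Henry1981, Thm. 1.3.4 and Thm. 1.4.3] -/
theorem exists_semigroupFrame_diagonalPMap [CompleteSpace H] (b : HilbertBasis ι ℝ H)
    {m : ι → ℝ} (hpos : ∀ i, 0 ≤ m i) (htend : Tendsto m cofinite atTop) :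
    ∃ (S R : H →L[ℝ] H) (T K : ℝ → H →L[ℝ] H),
      (∀ i, S (b i) = ((1 + m i) ^ (-(1 / 2 : ℝ))) • b i) ∧ (∀ i, R (b i) = (1 + m i)⁻¹ • b i) ∧
      (∀ t i, 0 ≤ t → T t (b i) = Real.exp (-(t * m i)) • b i) ∧
      (∀ t i, 0 < t → K t (b i) = ((m i) ^ (3 / 4 : ℝ) * Real.exp (-(t * m i))) • b i) ∧
      S.comp S = R ∧ Function.Injective S ∧ ‖S‖ ≤ 1 ∧ IsSelfAdjoint S ∧ IsCompactOperator S ∧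
      (∀ v : H, ∃ hv : R v ∈ (b.diagonalPMap m).domain, R v + b.diagonalPMap m ⟨R v, hv⟩ = v) ∧
      (∀ (v : H) (hv : v ∈ (b.diagonalPMap m).domain), R (v + b.diagonalPMap m ⟨v, hv⟩) = v) ∧
      (∀ (z : H) (hz : S z ∈ (b.diagonalPMap m).domain),
        ‖z‖ ^ 2 = ‖S z‖ ^ 2 + ⟪b.diagonalPMap m ⟨S z, hz⟩, S z⟫_ℝ) ∧
      (∀ t, 0 ≤ t → ‖T t‖ ≤ 1) ∧ T 0 = 1 ∧ (∀ s t, 0 ≤ s → 0 ≤ t → T (s + t) = (T s).comp (T t)) ∧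
      (∀ y : H, Continuous fun t : ℝ => T t y) ∧ (∀ t, (T t).comp S = S.comp (T t)) ∧
      (∀ t, 0 ≤ t → IsSelfAdjoint (T t)) ∧ (∀ t, 0 < t → IsCompactOperator (T t)) ∧
      (∀ t, 0 < t → ‖K t‖ ≤ t ^ (-(3 / 4 : ℝ))) ∧
      (∀ s t, 0 ≤ s → 0 < t → K (s + t) = (T s).comp (K t)) ∧
      (∀ t, (K t).comp S = S.comp (K t)) ∧
      (∀ y : H, ContinuousOn (fun t : ℝ => K t y) (Set.Ioi 0)) := by
  -- the symbol `(1 + m i)^{-1/2} ∈ (0, 1]` of `S`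
  have hm1 : ∀ i, 1 ≤ 1 + m i := fun i => le_add_of_nonneg_right (hpos i)
  have hm0 : ∀ i, 0 < 1 + m i := fun i => one_pos.trans_le (hm1 i)
  have hs0 : ∀ i, 0 < (1 + m i) ^ (-(1 / 2 : ℝ)) := fun i => Real.rpow_pos_of_pos (hm0 i) _
  have hs1 : ∀ i, ‖(1 + m i) ^ (-(1 / 2 : ℝ))‖ ≤ 1 := fun i => by
    rw [Real.norm_of_nonneg (hs0 i).le]
    exact Real.rpow_le_one_of_one_le_of_nonpos (hm1 i) (by norm_num)
  have hss : ∀ i, (1 + m i) ^ (-(1 / 2 : ℝ)) * (1 + m i) ^ (-(1 / 2 : ℝ)) = (1 + m i)⁻¹ :=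
    fun i => by
    rw [← Real.rpow_add (hm0 i), ← Real.rpow_neg_one (1 + m i)]
    norm_num
  obtain ⟨s₀, hs₀⟩ := exists_lp_infty_coe_eq (X := Unit)
    (f := fun _ i => (1 + m i) ^ (-(1 / 2 : ℝ))) (fun _ => 1) fun _ i => hs1 i
  set s := s₀ () with hs_def
  have hs : ∀ i, s i = (1 + m i) ^ (-(1 / 2 : ℝ)) := fun i => hs₀ () i
  -- the symbol `exp (-(max t 0) m i) ∈ (0, 1]` of `T t`
  have hT1 : ∀ (t : ℝ) i, ‖Real.exp (-(max t 0 * m i))‖ ≤ 1 := fun t i => by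
    rw [Real.norm_eq_abs, Real.abs_exp, Real.exp_le_one_iff, neg_nonpos]
    exact mul_nonneg (le_max_right _ _) (hpos i)
  obtain ⟨sT, hsT⟩ := exists_lp_infty_coe_eq (fun _ => (1 : ℝ)) hT1
  -- the symbol `m i ^ (3/4) exp (-t m i) ∈ [0, t ^ (-3/4)]` of `K t`, `t > 0` (and `0` for `t ≤ 0`)
  have hK1 : ∀ (t : ℝ) i, ‖(if 0 < t then (m i) ^ (3 / 4 : ℝ) * Real.exp (-(t * m i)) else 0)‖ ≤
      (if 0 < t then t ^ (-(3 / 4 : ℝ)) else 0) := fun t i => by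
    split_ifs with ht
    · rw [Real.norm_of_nonneg (mul_nonneg (Real.rpow_nonneg (hpos i) _) (Real.exp_pos _).le)]
      exact rpow_mul_exp_neg_le_rpow_neg (by norm_num) (by norm_num) ht (hpos i)
    · rw [norm_zero]
  obtain ⟨sK, hsK⟩ := exists_lp_infty_coe_eq _ hK1
  have hsK' : ∀ (t : ℝ) i, 0 < t → sK t i = (m i) ^ (3 / 4 : ℝ) * Real.exp (-(t * m i)) :=
    fun t i ht => by rw [hsK, if_pos ht]
  -- coordinates of `S` and of `R = S ∘ S`
  have hcoordS : ∀ (v : H) (i : ι),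
      b.repr (b.diagonalCLM s v) i = (1 + m i) ^ (-(1 / 2 : ℝ)) * b.repr v i := fun v i => by
    rw [b.diagonalCLM_apply_repr, hs]
  have hcoordR : ∀ (v : H) (i : ι),
      b.repr ((b.diagonalCLM s).comp (b.diagonalCLM s) v) i = (1 + m i)⁻¹ * b.repr v i :=
    fun v i => by rw [ContinuousLinearMap.comp_apply, hcoordS, hcoordS, ← mul_assoc, hss]
  -- the symbol `m i * (1 + m i)⁻¹ ∈ [0, 1)` of `diag(m) ∘ R`, and `R v ∈ D(diag m)`
  have hmr : Memℓp (fun i => m i * (1 + m i)⁻¹) ∞ := by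
    refine memℓp_infty ⟨1, ?_⟩
    rintro _ ⟨i, rfl⟩
    dsimp only
    rw [Real.norm_of_nonneg (mul_nonneg (hpos i) (inv_pos.2 (hm0 i)).le), ← div_eq_mul_inv,
      div_le_one (hm0 i)]
    exact le_add_of_nonneg_left zero_le_one
  have hdom : ∀ v : H, (b.diagonalCLM s).comp (b.diagonalCLM s) v ∈ (b.diagonalPMap m).domain :=
    fun v => by
    rw [HilbertBasis.diagonalPMap_domain, HilbertBasis.mem_diagonalDomain_iff]
    have h := hmr.infty_mul_left (lp.memℓp (b.repr v))
    refine (congrArg (Memℓp · 2) (funext fun i => ?_)).mp h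
    dsimp only
    rw [hcoordR, mul_assoc]
  -- the laws of `T` and `K` that are used twice
  have hTnorm : ∀ t, ‖b.diagonalCLM (sT t)‖ ≤ 1 := fun t =>
    norm_diagonalCLM_le_of_forall_le b _ zero_le_one fun i => by rw [hsT]; exact hT1 t i
  have hTcont : ∀ y, Continuous fun t : ℝ => b.diagonalCLM (sT t) y :=
    continuous_diagonalCLM_apply b sT (fun i => by simp only [hsT]; fun_prop) hTnorm
  have hKT : ∀ r t, 0 ≤ r → 0 < t →
      b.diagonalCLM (sK (r + t)) = (b.diagonalCLM (sT r)).comp (b.diagonalCLM (sK t)) :=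
    fun r t hr ht => (diagonalCLM_comp_eq b fun i => by
      rw [hsT, hsK' t i ht, hsK' (r + t) i (add_pos_of_nonneg_of_pos hr ht), max_eq_left hr,
        mul_left_comm, ← Real.exp_add]
      congr 2
      ring).symm
  refine ⟨b.diagonalCLM s, (b.diagonalCLM s).comp (b.diagonalCLM s),
    fun t => b.diagonalCLM (sT t), fun t => b.diagonalCLM (sK t), fun i => ?_, fun i => ?_,
    fun t i ht => ?_, fun t i ht => ?_, rfl, ?_, ?_, isSelfAdjoint_diagonalCLM b s, ?_,
    fun v => ⟨hdom v, ?_⟩, fun v hv => ?_, fun z hz => ?_, fun t _ => hTnorm t, ?_,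
    fun r t hr ht => ?_, hTcont, fun t => diagonalCLM_comp_comm b _ _,
    fun t _ => isSelfAdjoint_diagonalCLM b _, fun t ht => ?_, fun t ht => ?_, hKT,
    fun t => diagonalCLM_comp_comm b _ _, fun y t₁ ht₁ => ?_⟩
  · -- `S (b i) = (1 + m i)^{-1/2} • b i`
    rw [b.diagonalCLM_basis, hs]
  · -- `R (b i) = (1 + m i)⁻¹ • b i`
    rw [ContinuousLinearMap.comp_apply, b.diagonalCLM_basis, map_smul, b.diagonalCLM_basis,
      smul_smul, hs, hss]
  · -- `T t (b i) = exp (-t m i) • b i`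
    rw [b.diagonalCLM_basis, hsT, max_eq_left ht]
  · -- `K t (b i) = m i ^ (3/4) exp (-t m i) • b i`
    rw [b.diagonalCLM_basis, hsK' t i ht]
  · -- injective: the symbol does not vanish
    exact diagonalCLM_injective b fun i => by rw [hs]; exact (hs0 i).ne'
  · -- `‖S‖ ≤ 1`
    exact norm_diagonalCLM_le_of_forall_le b s zero_le_one fun i => by rw [hs]; exact hs1 i
  · -- `S` is compact: the symbol tends to zero
    refine b.isCompactOperator_diagonalCLM_of_tendsto_zero s ?_
    have h : Tendsto (fun i => (1 + m i) ^ (-(1 / 2 : ℝ))) cofinite (𝓝 0) :=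
      (tendsto_rpow_neg_atTop (by norm_num : (0 : ℝ) < 1 / 2)).comp
        (tendsto_atTop_add_const_left _ 1 htend)
    refine (tendsto_zero_iff_norm_tendsto_zero.mp h).congr fun i => ?_
    rw [hs]
  · -- `R v + diag(m) (R v) = v`, coefficientwise `(1 + m i) (1 + m i)⁻¹ c = c`
    apply b.repr.injective
    ext i
    rw [map_add, lp.coeFn_add, Pi.add_apply, HilbertBasis.repr_diagonalPMap_apply]
    change b.repr ((b.diagonalCLM s).comp (b.diagonalCLM s) v) i +
      m i * b.repr ((b.diagonalCLM s).comp (b.diagonalCLM s) v) i = b.repr v i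
    rw [hcoordR]
    calc (1 + m i)⁻¹ * b.repr v i + m i * ((1 + m i)⁻¹ * b.repr v i)
        = (1 + m i) * (1 + m i)⁻¹ * b.repr v i := by ring
      _ = b.repr v i := by rw [mul_inv_cancel₀ (hm0 i).ne', one_mul]
  · -- `R (v + diag(m) v) = v`, coefficientwise `(1 + m i)⁻¹ (1 + m i) c = c`
    apply b.repr.injective
    ext i
    rw [hcoordR, map_add, lp.coeFn_add, Pi.add_apply, HilbertBasis.repr_diagonalPMap_apply]
    change (1 + m i)⁻¹ * (b.repr v i + m i * b.repr v i) = b.repr v i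
    calc (1 + m i)⁻¹ * (b.repr v i + m i * b.repr v i)
        = (1 + m i)⁻¹ * (1 + m i) * b.repr v i := by ring
      _ = b.repr v i := by rw [inv_mul_cancel₀ (hm0 i).ne', one_mul]
  · -- the frame identity, by Parseval: `|c|² = (1 + m)⁻¹ |c|² + m (1 + m)⁻¹ |c|²` coefficientwise
    have h0 := lp.hasSum_inner (𝕜 := ℝ) (b.repr z) (b.repr z)
    have h1 := lp.hasSum_inner (𝕜 := ℝ) (b.repr (b.diagonalCLM s z)) (b.repr (b.diagonalCLM s z))
    have h2 := lp.hasSum_inner (𝕜 := ℝ) (b.repr (b.diagonalPMap m ⟨b.diagonalCLM s z, hz⟩))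
      (b.repr (b.diagonalCLM s z))
    rw [b.repr.inner_map_map, real_inner_self_eq_norm_sq] at h0 h1
    rw [b.repr.inner_map_map] at h2
    have h12 := h1.add h2
    have hfun : (fun i => ⟪b.repr (b.diagonalCLM s z) i, b.repr (b.diagonalCLM s z) i⟫_ℝ +
        ⟪b.repr (b.diagonalPMap m ⟨b.diagonalCLM s z, hz⟩) i, b.repr (b.diagonalCLM s z) i⟫_ℝ) =
        fun i => ⟪b.repr z i, b.repr z i⟫_ℝ := by
      funext i
      rw [HilbertBasis.repr_diagonalPMap_apply]
      change ⟪b.repr (b.diagonalCLM s z) i, b.repr (b.diagonalCLM s z) i⟫_ℝ +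
        ⟪m i * b.repr (b.diagonalCLM s z) i, b.repr (b.diagonalCLM s z) i⟫_ℝ =
        ⟪b.repr z i, b.repr z i⟫_ℝ
      simp only [hcoordS, RCLike.inner_apply, RCLike.conj_to_real]
      calc (1 + m i) ^ (-(1 / 2 : ℝ)) * b.repr z i * ((1 + m i) ^ (-(1 / 2 : ℝ)) * b.repr z i) +
            (1 + m i) ^ (-(1 / 2 : ℝ)) * b.repr z i *
              (m i * ((1 + m i) ^ (-(1 / 2 : ℝ)) * b.repr z i))
          = (1 + m i) * ((1 + m i) ^ (-(1 / 2 : ℝ)) * (1 + m i) ^ (-(1 / 2 : ℝ))) *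
              (b.repr z i * b.repr z i) := by ring
        _ = b.repr z i * b.repr z i := by rw [hss, mul_inv_cancel₀ (hm0 i).ne', one_mul]
    rw [hfun] at h12
    exact h0.unique h12
  · -- `T 0 = 1`
    refine (diagonalCLM_congr b (s' := 1) fun i => ?_).trans b.diagonalCLM_one
    rw [hsT, max_self, zero_mul, neg_zero, Real.exp_zero, lp.infty_coeFn_one, Pi.one_apply]
  · -- `T (r + t) = T r ∘ T t`
    refine (diagonalCLM_comp_eq b fun i => ?_).symm
    rw [hsT, hsT, hsT, max_eq_left hr, max_eq_left ht, max_eq_left (add_nonneg hr ht),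
      ← Real.exp_add]
    congr 1
    ring
  · -- `T t` is compact for `t > 0`: the symbol `exp (-t m i)` tends to zero
    refine b.isCompactOperator_diagonalCLM_of_tendsto_zero _ ?_
    have h : Tendsto (fun i => Real.exp (-(t * m i))) cofinite (𝓝 0) :=
      Real.tendsto_exp_neg_atTop_nhds_zero.comp (htend.const_mul_atTop ht)
    refine (tendsto_zero_iff_norm_tendsto_zero.mp h).congr fun i => ?_
    rw [hsT, max_eq_left ht.le]
  · -- `‖K t‖ ≤ t ^ (-3/4)`
    refine norm_diagonalCLM_le_of_forall_le b _ (Real.rpow_nonneg ht.le _) fun i => ?_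
    have h := hK1 t i
    rw [if_pos ht, if_pos ht] at h
    rwa [hsK' t i ht]
  · -- strong continuity of `K` on `(0, ∞)`: `K t = T (t - t₁/2) ∘ K (t₁/2)` near `t₁`
    refine ContinuousAt.continuousWithinAt ?_
    have hcont : Continuous fun t : ℝ =>
        b.diagonalCLM (sT (t - t₁ / 2)) (b.diagonalCLM (sK (t₁ / 2)) y) :=
      (hTcont _).comp (continuous_id.sub continuous_const)
    refine hcont.continuousAt.congr ?_
    filter_upwards [Ioi_mem_nhds (half_lt_self (Set.mem_Ioi.1 ht₁))] with t ht
    have h := hKT (t - t₁ / 2) (t₁ / 2) (sub_nonneg.2 (Set.mem_Ioi.1 ht).le)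
      (half_pos (Set.mem_Ioi.1 ht₁))
    rw [sub_add_cancel] at h
    rw [h, ContinuousLinearMap.comp_apply]

end Literature.Analysis.FluidPDE
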